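import Summits.AtomisticToContinuum.HydrodynamicLimit.Theorems.LambertianContactSwapLambertianEulerCollisionalInputs
import Summits.AtomisticToContinuum.HydrodynamicLimit.Theorems.ImplosionDichotomyHydroLimitInBandWindowContinuityFields
import Summits.AtomisticToContinuum.HydrodynamicLimit.Theorems.LambertianContactSwapLambertianEulerTimeLedgerStopping
import HarnessLib

/-!
# CAT-Λ from its Euler-free collision-activity core (crux `LambertianEuler`, stmt-AtomisticToContinuum-11854, line `Sketch`, stub `collisionActivityTailsLambda_of_core`)

Support file (`--supports stmt-AtomisticToContinuum-11854`).  Registered sub-goal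
`collisionActivityTailsLambda_of_core` (S5 of lead c9): the research input CAT-Λ
(`…CollisionalInputs.CollisionActivityTailsLambda`, collision-activity tails of the compensated jump sum along the
Lambertian flow `Λ`) follows from

* the PAIR BOUND (sub-goal `abs_Jcol_le_pair`, taken here as a hypothesis): along profiles whose coefficient fields
  `u/θ`, `θ⁻¹` are `L`-Lipschitz in space on `[0, t₁]` with `θ > 0`, the compensated jump `Jcol` at a post-collisional
  state `w` vanishes when the exit configuration `w♭` has no incoming pair, and otherwise
  `|Jcol| ≤ 2 L ε_N (1 + ‖v_i‖² + ‖v_j‖²)` for the redrawn pair `(i, j)`;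
* the EULER-FREE CORE (research): Gaussian-in-`V` `L¹` tails, eventually in `N` and uniformly over macroscopic
  windows `[a', a'+h] ⊆ [0, t]`, of the kinetic content `ε_N (1 + ‖v_i‖² + ‖v_j‖²)` of the FAST incoming pairs
  (`V² < 1 + ‖v_i‖² + ‖v_j‖²`) at the counted contacts plus `ε_N V²` times the overflow of the window collision count
  above `R₀ h (N+1)^{4/3}`.

## Proof

Given the insertion factor (unused) take the band `ηt := 1` (unused); given the data take the core's `σ₀`; given a
classical hs-Euler solution on `[0, T)` and `t ∈ (0, T)`, the coefficient fields `u_j/θ`, `θ⁻¹` are jointly smooth,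
hence `L`-Lipschitz in the minimal-image distance on the compact slab `[0, t] × 𝕋³`
(`…WindowContinuityFields.exists_lipschitz_slab`).  With the core's `R₀, A, a` answer CAT-Λ with `R₀`,
`c_J := max (2L) 1`, `A' := c_J A`, `a`.  Pointwise in the sample `p`: the overflow integrand of CAT-Λ is `c_J ×` the
core's (`jumpLevel = c_J ε_N V²`); for a counted contact `m < K_{a'+h}` the instant `t_{m+1} ≤ a' + h ≤ t` lies in the
slab (`instant_succ_le_of_lt_count`, unconditionally: on the Zeno set the count is the junk value `0`), so the pair
bound applies at `(t_{m+1}, z_m)`: no incoming pair gives `(|0| − ℓ)₊ = 0`; a fast redrawn pair gives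
`(|Jcol| − ℓ)₊ ≤ 2Lε(1+s) ≤ c_J ε (1+s)`, one nonnegative term of the core's pair sum; a slow one (`1 + s ≤ V²`) gives
`|Jcol| ≤ 2LεV² ≤ ℓ`, so the excess vanishes (`max_sub_level_le`).  Summing, `lintegral_mono` and
`lintegral_const_mul'` (no measurability needed) give `I₁ + I₂ ≤ c_J (J₁ + J₂) ≤ c_J A e^{−aV²} h (N+1)`
(`lintegral_add_le_of_pointwise`).

References: H.-T. Yau, *Relative entropy and hydrodynamics of Ginzburg–Landau models*, Lett. Math. Phys. 22 (1991) §2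
(the gradient-across-the-range bookkeeping); measure theory otherwise.  All statements here [folklore].
-/

noncomputable section

namespace Summit.AtomisticToContinuum.HydrodynamicLimit.Theorems.LambertianContactSwapLambertianEulerCollisionActivityCore

open scoped BigOperators Topology ENNReal InnerProductSpace
open MeasureTheory ProbabilityTheory Filter Set InformationTheory
open Literature.MathematicalPhysics.KineticTheory
open Literature.Analysis.FluidPDE Literature.Analysis.FluidPDE.Alexander
open Summit.AtomisticToContinuum.HydrodynamicLimit.Theorems.LambertianContactSwapLambertianEulerCollisionalInputs
open Summit.AtomisticToContinuum.HydrodynamicLimit.Theorems.HydroLimitInBandContinuity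
  (exists_lipschitz_slab isSmoothSpaceTimeOn_momPart isSmoothSpaceTimeOn_inv)
open Summit.AtomisticToContinuum.HydrodynamicLimit.Theorems.LambertianContactSwapLambertianEulerTimeLedgerStopping
  (instant_succ_le_of_lt_lambertCount)

/-! ## Three elementary lemmas -/

/-- Counted collisions happened by the counting time, unconditionally: `m < K_u → t_{m+1} ≤ u` (off the Zeno set this
is `…TimeLedgerStopping.instant_succ_le_of_lt_lambertCount`; on it the count is the junk value `0`). [folklore] -/
theorem instant_succ_le_of_lt_count {d : Type*} [Fintype d] {X : Type*} {N : ℕ} {G : Geometry d X} {ε : ℝ}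
    {ξs : ℕ → EuclideanSpace ℝ d} {z : Config N d X} {u : ℝ} {m : ℕ} (hm : m < lambertCount G ε ξs z u) :
    lambertInstant G ε ξs z (m + 1) ≤ ENNReal.ofReal u := by
  by_cases hex : ∃ k, ENNReal.ofReal u < lambertInstant G ε ξs z k
  · exact instant_succ_le_of_lt_lambertCount hex hm
  · push Not at hex
    have hK : lambertCount G ε ξs z u = 0 := by
      show sSup {k : ℕ | lambertInstant G ε ξs z k ≤ ENNReal.ofReal u} = 0
      refine Nat.sSup_of_not_bddAbove ?_
      rintro ⟨n, hn⟩
      exact Nat.not_succ_le_self n (hn (hex (n + 1)))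
    omega

/-- **The pointwise clamp bookkeeping of one contact.**  If `J = 0` without an incoming pair and
`|J| ≤ 2Lε(1 + e₁ + e₂)` at the chosen pair otherwise, then for `c_J ≥ 2L` the excess `(|J| − c_J ε V²)₊` is at most
`c_J ×` the sum over incoming pairs of the fast-pair content `𝟙{V² < 1 + e₁ + e₂} ε (1 + e₁ + e₂)`. [folklore] -/
theorem max_sub_level_le {ι : Type*} [Fintype ι] {S : Set ι} {e₁ e₂ : ι → ℝ}
    (he₁ : ∀ q, 0 ≤ e₁ q) (he₂ : ∀ q, 0 ≤ e₂ q) {J L ε V cJ : ℝ} (hε : 0 ≤ ε) (hL : 0 ≤ L) (hcJ : 2 * L ≤ cJ)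
    (h0 : ¬ S.Nonempty → J = 0)
    (h1 : ∀ hne : S.Nonempty, |J| ≤ 2 * L * ε * (1 + e₁ hne.some + e₂ hne.some)) :
    max (|J| - cJ * ε * V ^ 2) 0 ≤
      cJ * ∑ q, S.indicator (fun q' => if V ^ 2 < 1 + e₁ q' + e₂ q' then ε * (1 + e₁ q' + e₂ q') else 0) q := by
  have hcJ0 : 0 ≤ cJ := le_trans (by positivity) hcJ
  set g : ι → ℝ := fun q' => if V ^ 2 < 1 + e₁ q' + e₂ q' then ε * (1 + e₁ q' + e₂ q') else 0 with hg
  have hg0 : ∀ q, 0 ≤ S.indicator g q := by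
    intro q
    refine Set.indicator_nonneg (fun q' _ => ?_) q
    simp only [hg]
    split_ifs
    · have := he₁ q'; have := he₂ q'; positivity
    · exact le_rfl
  have hrhs : 0 ≤ cJ * ∑ q, S.indicator g q := mul_nonneg hcJ0 (Finset.sum_nonneg fun q _ => hg0 q)
  have hℓ0 : 0 ≤ cJ * ε * V ^ 2 := by positivity
  refine max_le ?_ hrhs
  by_cases hne : S.Nonempty
  · have hJ := h1 hne
    have hs0 : 0 ≤ 1 + e₁ hne.some + e₂ hne.some := by
      have := he₁ hne.some; have := he₂ hne.some; positivity
    by_cases hV : V ^ 2 < 1 + e₁ hne.some + e₂ hne.some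
    · -- a fast pair: the excess is at most the `q := hne.some` term of the pair sum
      have hterm : S.indicator g hne.some = ε * (1 + e₁ hne.some + e₂ hne.some) := by
        rw [Set.indicator_of_mem hne.some_mem, hg]
        exact if_pos hV
      have hsingle : S.indicator g hne.some ≤ ∑ q, S.indicator g q :=
        Finset.single_le_sum (fun q _ => hg0 q) (Finset.mem_univ hne.some)
      rw [hterm] at hsingle
      have hkey : 2 * L * ε * (1 + e₁ hne.some + e₂ hne.some) ≤ cJ * (ε * (1 + e₁ hne.some + e₂ hne.some)) := by
        rw [← mul_assoc]
        exact mul_le_mul_of_nonneg_right (mul_le_mul_of_nonneg_right hcJ hε) hs0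
      have hmono : cJ * (ε * (1 + e₁ hne.some + e₂ hne.some)) ≤ cJ * ∑ q, S.indicator g q :=
        mul_le_mul_of_nonneg_left hsingle hcJ0
      linarith
    · -- a slow pair: the jump is below the level
      have hV' : 1 + e₁ hne.some + e₂ hne.some ≤ V ^ 2 := not_lt.1 hV
      have hkey : 2 * L * ε * (1 + e₁ hne.some + e₂ hne.some) ≤ cJ * ε * V ^ 2 :=
        mul_le_mul (mul_le_mul_of_nonneg_right hcJ hε) hV' hs0 (mul_nonneg hcJ0 hε)
      linarith
  · -- no incoming pair: no jump
    rw [h0 hne, abs_zero]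
    linarith

/-- **From pointwise domination to the `lintegral` bound.**  If `f₁ ≤ c g₁` and `f₂ = c g₂` pointwise (`c ≥ 0`) and
`∫⁻ g₁⁺ + ∫⁻ g₂⁺ ≤ B`, then `∫⁻ f₁⁺ + ∫⁻ f₂⁺ ≤ c B` (monotonicity and `lintegral_const_mul'`; no measurability).
[folklore] -/
theorem lintegral_add_le_of_pointwise {α : Type*} [MeasurableSpace α] {μ : Measure α}
    {f₁ f₂ g₁ g₂ : α → ℝ} {c B B' : ℝ} (hc : 0 ≤ c) (h₁ : ∀ p, f₁ p ≤ c * g₁ p) (h₂ : ∀ p, f₂ p = c * g₂ p)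
    (hB : ∫⁻ p, ENNReal.ofReal (g₁ p) ∂μ + ∫⁻ p, ENNReal.ofReal (g₂ p) ∂μ ≤ ENNReal.ofReal B)
    (hB' : c * B = B') :
    ∫⁻ p, ENNReal.ofReal (f₁ p) ∂μ + ∫⁻ p, ENNReal.ofReal (f₂ p) ∂μ ≤ ENNReal.ofReal B' := by
  subst hB'
  calc ∫⁻ p, ENNReal.ofReal (f₁ p) ∂μ + ∫⁻ p, ENNReal.ofReal (f₂ p) ∂μ
      ≤ ∫⁻ p, ENNReal.ofReal c * ENNReal.ofReal (g₁ p) ∂μ + ∫⁻ p, ENNReal.ofReal c * ENNReal.ofReal (g₂ p) ∂μ := by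
        refine add_le_add (lintegral_mono fun p => ?_) (lintegral_mono fun p => ?_)
        · rw [← ENNReal.ofReal_mul hc]
          exact ENNReal.ofReal_le_ofReal (h₁ p)
        · rw [← ENNReal.ofReal_mul hc, h₂ p]
    _ = ENNReal.ofReal c * (∫⁻ p, ENNReal.ofReal (g₁ p) ∂μ + ∫⁻ p, ENNReal.ofReal (g₂ p) ∂μ) := by
        rw [lintegral_const_mul' _ _ ENNReal.ofReal_ne_top, lintegral_const_mul' _ _ ENNReal.ofReal_ne_top, mul_add]
    _ ≤ ENNReal.ofReal c * ENNReal.ofReal B := by gcongr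
    _ = ENNReal.ofReal (c * B) := (ENNReal.ofReal_mul hc).symm

/-! ## The stub -/

/-- **S5: CAT-Λ from its Euler-free core and the pair bound** (registered sub-goal
`collisionActivityTailsLambda_of_core` of lead c9, line `Sketch`, crux stmt-AtomisticToContinuum-11854).  Along a
classical hs-Euler solution the coefficient fields are Lipschitz on the slab `[0, t] × 𝕋³`, so the pair bound prices
every counted contact of a window `[a', a'+h] ⊆ [0, t]`: with `c_J := max (2L) 1` the excess of `|Jcol|` over the level
`c_J ε_N V²` is carried by the fast pairs, and the overflow term is `c_J ×` the core's. [folklore] -/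
theorem collisionActivityTailsLambda_of_core :
    (∀ {σ : ℝ}, 0 < σ → ∀ (Rf : ℝ → ℝ) (ρ θ : ℝ → T3 → ℝ) (u : ℝ → T3 → V3) (L t₁ : ℝ), 0 ≤ L →
      (∀ r ∈ Set.Icc 0 t₁, ∀ (x x' : T3) (j : Fin 3), |u r x j / θ r x - u r x' j / θ r x'| ≤ L * Torus.euclidDist x x') →
      (∀ r ∈ Set.Icc 0 t₁, ∀ x x' : T3, |(θ r x)⁻¹ - (θ r x')⁻¹| ≤ L * Torus.euclidDist x x') →
      (∀ r ∈ Set.Icc 0 t₁, ∀ x, 0 < θ r x) →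
      ∀ (N : ℕ), ∀ t ∈ Set.Icc 0 t₁, ∀ w : Config (N + 1) (Fin 3) T3,
        (¬ (incomingPairs (Torus.geometry (Fin 3)) (hsDiameter σ N)
              (freeFlight (Torus.geometry (Fin 3)) (freeExitTime (Torus.geometry (Fin 3)) (hsDiameter σ N) w).toReal w)).Nonempty →
            Jcol σ Rf ρ θ u N t w = 0) ∧
        ∀ hne : (incomingPairs (Torus.geometry (Fin 3)) (hsDiameter σ N)
            (freeFlight (Torus.geometry (Fin 3)) (freeExitTime (Torus.geometry (Fin 3)) (hsDiameter σ N) w).toReal w)).Nonempty,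
          |Jcol σ Rf ρ θ u N t w| ≤
            2 * L * hsDiameter σ N * (1 + ‖(w hne.some.1).2‖ ^ 2 + ‖(w hne.some.2).2‖ ^ 2)) →
    (∀ (a₀ θ₀ : T3 → ℝ) (u₀ : T3 → V3), Continuous a₀ → Continuous θ₀ → Continuous u₀ →
      (∀ x, 0 < a₀ x) → (∀ x, 0 < θ₀ x) →
      ∃ σ₀ : ℝ, 0 < σ₀ ∧ ∀ σ : ℝ, 0 < σ → σ < σ₀ →
        ∀ Φ : (N : ℕ) → HardSphereFlow (Torus.geometry (Fin 3)) (hsDiameter σ N) (N + 1),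
        ∀ t : ℝ, 0 < t → ∃ R₀ A a : ℝ, 1 ≤ R₀ ∧ 0 < A ∧ 0 < a ∧
          ∀ V : ℝ, 1 ≤ V → ∀ h₀ : ℝ, 0 < h₀ → ∃ N₀ : ℕ, ∀ N : ℕ, N₀ ≤ N →
            ∀ (a' h : ℝ), 0 ≤ a' → h₀ ≤ h → h ≤ 2 * h₀ → a' + h ≤ t →
              (∫⁻ p, ENNReal.ofReal
                  (∑ m ∈ Finset.range (lambertCount (Torus.geometry (Fin 3)) (hsDiameter σ N) p.2 p.1 (a' + h)),
                    if a' < (lambertInstant (Torus.geometry (Fin 3)) (hsDiameter σ N) p.2 p.1 (m + 1)).toReal then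
                      ∑ q : Fin (N + 1) × Fin (N + 1),
                        (incomingPairs (Torus.geometry (Fin 3)) (hsDiameter σ N)
                          (freeFlight (Torus.geometry (Fin 3))
                            (freeExitTime (Torus.geometry (Fin 3)) (hsDiameter σ N)
                              (lambertStateAfter (Torus.geometry (Fin 3)) (hsDiameter σ N) p.2 p.1 m)).toReal
                            (lambertStateAfter (Torus.geometry (Fin 3)) (hsDiameter σ N) p.2 p.1 m))).indicator
                          (fun q' => if V ^ 2 < 1 + ‖(lambertStateAfter (Torus.geometry (Fin 3)) (hsDiameter σ N) p.2 p.1 m q'.1).2‖ ^ 2 +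
                                ‖(lambertStateAfter (Torus.geometry (Fin 3)) (hsDiameter σ N) p.2 p.1 m q'.2).2‖ ^ 2 then
                              hsDiameter σ N * (1 + ‖(lambertStateAfter (Torus.geometry (Fin 3)) (hsDiameter σ N) p.2 p.1 m q'.1).2‖ ^ 2 +
                                ‖(lambertStateAfter (Torus.geometry (Fin 3)) (hsDiameter σ N) p.2 p.1 m q'.2).2‖ ^ 2) else 0) q
                    else 0)
                ∂((localGibbsLaw σ a₀ u₀ θ₀ N (Φ N)).prod (lambertNoise (Fin 3)))) +
              (∫⁻ p, ENNReal.ofReal (hsDiameter σ N * V ^ 2 *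
                  (((lambertCount (Torus.geometry (Fin 3)) (hsDiameter σ N) p.2 p.1 (a' + h) : ℕ) : ℝ) -
                    ((lambertCount (Torus.geometry (Fin 3)) (hsDiameter σ N) p.2 p.1 a' : ℕ) : ℝ) -
                    R₀ * h * ((N : ℝ) + 1) ^ (4 / 3 : ℝ)))
                ∂((localGibbsLaw σ a₀ u₀ θ₀ N (Φ N)).prod (lambertNoise (Fin 3)))) ≤
              ENNReal.ofReal (A * Real.exp (-(a * V ^ 2)) * h * ((N : ℝ) + 1))) →
    CollisionActivityTailsLambda := by
  intro H1 H2 _ Rf _ _ _ _ _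
  refine ⟨1, one_pos, ?_⟩
  intro a₀ θ₀ u₀ hac hθc huc ha0 hθ0
  obtain ⟨σ₀, hσ₀, Hc⟩ := H2 a₀ θ₀ u₀ hac hθc huc ha0 hθ0
  refine ⟨σ₀, hσ₀, ?_⟩
  intro σ hσ hσlt T ρ θ u hE _ Φ _ t ht
  -- Lipschitz constants of the coefficient fields `u_j/θ`, `θ⁻¹` on the slab `[0, t] × 𝕋³`
  choose Lb hLb0 hLb using fun j : Fin 3 => exists_lipschitz_slab
    (isSmoothSpaceTimeOn_momPart hE.smooth_temperature hE.smooth_velocity hE.temperature_pos j) ht.1 ht.2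
  obtain ⟨Lγ, hLγ0, hLγ⟩ := exists_lipschitz_slab
    (isSmoothSpaceTimeOn_inv hE.smooth_temperature hE.temperature_pos) ht.1 ht.2
  have hSL0 : 0 ≤ ∑ j, Lb j := Finset.sum_nonneg fun j _ => hLb0 j
  obtain ⟨L, hLdef⟩ : ∃ L : ℝ, L = ∑ j, Lb j + Lγ := ⟨_, rfl⟩
  have hL0 : 0 ≤ L := by rw [hLdef]; positivity
  have hd0 : ∀ x x' : T3, 0 ≤ Torus.euclidDist x x' := fun x x' => by
    rw [Torus.euclidDist_eq]; exact norm_nonneg _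
  have hβ : ∀ r' ∈ Icc 0 t, ∀ (x x' : T3) (j : Fin 3),
      |u r' x j / θ r' x - u r' x' j / θ r' x'| ≤ L * Torus.euclidDist x x' := by
    intro r' hr' x x' j
    have h := hLb j r' hr' r' hr' x x'
    rw [sub_self, abs_zero, zero_add, Real.norm_eq_abs] at h
    refine h.trans (mul_le_mul_of_nonneg_right ?_ (hd0 x x'))
    have := Finset.single_le_sum (fun j _ => hLb0 j) (Finset.mem_univ j)
    rw [hLdef]
    linarith
  have hγ : ∀ r' ∈ Icc 0 t, ∀ x x' : T3, |(θ r' x)⁻¹ - (θ r' x')⁻¹| ≤ L * Torus.euclidDist x x' := by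
    intro r' hr' x x'
    have h := hLγ r' hr' r' hr' x x'
    rw [sub_self, abs_zero, zero_add, Real.norm_eq_abs] at h
    refine h.trans (mul_le_mul_of_nonneg_right ?_ (hd0 x x'))
    rw [hLdef]
    linarith
  have htT : Icc 0 t ⊆ Ico 0 T := Icc_subset_Ico_right ht.2
  have hθpos : ∀ r' ∈ Icc 0 t, ∀ x, 0 < θ r' x := fun r' hr' x => hE.temperature_pos r' (htT hr') x
  -- the core's constants, and the level constant `c_J := max (2L) 1`
  obtain ⟨R₀, A, a, hR₀, hA, hapos, Hcore⟩ := Hc σ hσ hσlt Φ t ht.1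
  obtain ⟨cJ, hcJdef⟩ : ∃ cJ : ℝ, cJ = max (2 * L) 1 := ⟨_, rfl⟩
  have hcJ0 : 0 < cJ := by rw [hcJdef]; exact lt_max_of_lt_right one_pos
  have hcJge : 2 * L ≤ cJ := by rw [hcJdef]; exact le_max_left _ _
  refine ⟨R₀, cJ, cJ * A, a, hR₀, hcJ0, mul_pos hcJ0 hA, hapos, ?_⟩
  intro V hV h₀ hh₀
  obtain ⟨N₀, HN⟩ := Hcore V hV h₀ hh₀
  refine ⟨N₀, fun N hN a' h ha' hh1 hh2 hah => ?_⟩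
  refine lintegral_add_le_of_pointwise hcJ0.le (fun p => ?_) (fun p => ?_) (HN N hN a' h ha' hh1 hh2 hah) (by ring)
  · -- the jump-excess integrand ≤ `c_J ×` the fast-pair integrand, contact by contact
    rw [Finset.mul_sum]
    refine Finset.sum_le_sum fun m hm => ?_
    split_ifs with hlt
    · have hle := (instant_succ_le_of_lt_count (Finset.mem_range.1 hm)).trans (ENNReal.ofReal_le_ofReal hah)
      have htm : (lambertInstant (Torus.geometry (Fin 3)) (hsDiameter σ N) p.2 p.1 (m + 1)).toReal ∈ Icc 0 t :=
        ⟨ENNReal.toReal_nonneg, ENNReal.toReal_le_of_le_ofReal ht.1.le hle⟩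
      obtain ⟨h0, h1⟩ := H1 hσ Rf ρ θ u L t hL0 hβ hγ hθpos N _ htm
        (lambertStateAfter (Torus.geometry (Fin 3)) (hsDiameter σ N) p.2 p.1 m)
      unfold jumpLevel
      exact max_sub_level_le (fun q => by positivity) (fun q => by positivity) (hsDiameter_pos hσ N).le hL0 hcJge
        h0 h1
    · rw [mul_zero]
  · -- the overflow integrand is `c_J ×` the core's
    simp only [jumpLevel]
    ring

end Summit.AtomisticToContinuum.HydrodynamicLimit.Theorems.LambertianContactSwapLambertianEulerCollisionActivityCore
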